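import Literature.AlgebraicGeometry.Motives.AbsoluteFlatModelTransition
import Literature.AlgebraicGeometry.Motives.ThickeningTower
import Mathlib.AlgebraicGeometry.AlgClosed.Basic
import HarnessLib

/-!
# The thickenings `Spec(𝒪_{T,x}/𝔪^{n+1})` as spectra of `K`-algebras

For a scheme `T → Spec K` over a field `K` and a point `x` (of an open `B ⊆ T`, conventions of
`Motives/ThickeningTower`: `stalkAt T x = 𝒪_{T,x}`, `thickRing T x n = 𝒪_{T,x}/𝔪^{n+1}`, `resField T x = κ(x)`):

* the `K`-algebra structures on `𝒪_{T,x}`, `𝒪_{T,x}/𝔪^{n+1}`, `κ(x)` are Mathlib's quotient instances on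
  top of the tree's `RatFn.algebraStalk` (nothing declared here); `Spec_map_algebraMap_stalkAt`
  (`Spec(K → 𝒪_{T,x}) = (Spec 𝒪_{T,x} → T → Spec K)`), `thickeningPt_hom_eq_Spec_algebraMap` and
  **`thickeningPt_eq_specOver : thickeningPt T x n = specOver K (𝒪_{T,x}/𝔪^{n+1})`** (equality in
  `Over (Spec K)`), `residuePt_eq_specOver`; the transition and residue maps as `K`-algebra maps
  `thickπₐ`, `thickρₐ` (equal to the tree's `thickπ`, `thickρ` as ring maps) and
  `whiskerLeft_thickeningPtTransition_left` (the transition of infinitesimal neighbourhoods is the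
  `absTransition` of `Motives/AbsoluteFlatModel`);
* for `K` algebraically closed, `T → Spec K` locally of finite type and `x` closed:
  `algebraMap_resField_bijective` (`κ(x) = K`, Mathlib `residueFieldIsoBase`), `resFieldEquiv`, the
  augmentations `thickAug n : 𝒪_{T,x}/𝔪^{n+1} →ₐ[K] K` and, for `T` locally noetherian, the small
  extensions `𝒪/𝔪^{n+2} → 𝒪/𝔪^{n+1}` over `K` with framed kernel (`thickSmallExtensionₐ`, the tree's
  `thickSmallExtension` read through `κ(x) = K`);
* the Artinian factorisation of centred `R`-points through `thickeningPt T x n` is in the sibling file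
  `Motives/ThickeningArtinianPoints`;
* `fromSpec_comp_hom_eq_Spec_algebraMap` — the chart `Spec Γ(U, 𝒪_Z) → Z` of an affine open of a
  `K`-scheme is a `K`-morphism for the `Sections Z.hom U` algebra structure (`fromSpecOver`).

These are the «chart points at level `n`» of infinitesimal lifting arguments over the local Artinian
quotients `A = 𝒪_{S,s}/𝔪^{n+1}` (Görtz–Wedhorn II, Lemma 24.72 and its proof; the small-extension lifting
diagram of Prop. 27.208). Everything is proved; no named facts.
Mathlib searched (pin): `Scheme.fromSpecStalk_toSpecΓ`, `Scheme.toSpecΓ_naturality`,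
`SpecMap_ΓSpecIso_hom`, `residueFieldIsoBase`, `SpecMap_residueFieldIsoBase_inv`,
`Ideal.Quotient.factorₐ`, `Ideal.Quotient.liftₐ`, `Scheme.stalkClosedPointTo`,
`Scheme.Spec_stalkClosedPointTo_fromSpecStalk`, `Scheme.SpecMap_stalkSpecializes_fromSpecStalk`,
`SpecToEquivOfLocalRing`, `IsLocalRing.of_surjective'`, `map_maximalIdeal_of_surjective`,
`IsAffineOpen.SpecMap_appLE_fromSpec`, `IsAffineOpen.fromSpec_top` (used).

## References

* The Stacks Project, Tag 01J6 (Schemes, Lemma 26.13.1: points with values in a local ring), Tag 01I1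
  (Schemes, Lemma 26.6.4), Tag 01TF (Morphisms, Lemma 29.21.3). [StacksProject]
* U. Görtz, T. Wedhorn, *Algebraic Geometry I: Schemes*, 2nd ed., Springer Spektrum (2020): Section (4.7),
  pp. 107–108 (base change). [GortzWedhorn2020]
* U. Görtz, T. Wedhorn, *Algebraic Geometry II: Cohomology of Schemes*, Springer Spektrum (2023),
  doi:10.1007/978-3-658-43031-3: Lemma 24.72 (p. 409), proof, Steps (I)–(II) (p. 410); Prop. 27.208 (p. 685).
  [GortzWedhorn2023]
-/

universe u

open CategoryTheory CategoryTheory.Limits AlgebraicGeometry TopologicalSpace Opposite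
open TensorProduct IsLocalRing MonoidalCategory
open Literature.AlgebraicGeometry.Morphisms

noncomputable section

namespace Literature.AlgebraicGeometry.Motives

/-! ## §2 (α5) The thickenings `Spec(𝒪_{T,x}/𝔪^{n+1})` as spectra of `K`-algebras -/

section Thickenings

variable {K : Type u} [Field K] (T : SchemeOver K) {B : T.left.Opens} (x : B)

/-! ### The `K`-algebra structures (instances already in the tree / Mathlib) -/

/-- The `K`-algebra structure of `𝒪_{T,x}` (the tree's instance `RatFn.algebraStalk`, through
Mathlib's `OverClass.fromOver T`): `K = Γ(Spec K, 𝒪) → Γ(T, 𝒪_T) → 𝒪_{T,x}`. [cite: StacksProject, Tag 01I1 (Schemes, Lemma 26.6.4) and Tag 01J6 (Schemes, Lemma 26.13.1)] -/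
theorem algebraMap_stalkAt_eq : (CommRingCat.ofHom (algebraMap K (stalkAt T x)) : _ ⟶ _) =
    (Scheme.ΓSpecIso (.of K)).inv ≫ T.hom.appTop ≫ T.left.presheaf.germ ⊤ x.1 trivial :=
  rfl

/-- The `K`-algebra structure of `A_n = 𝒪_{T,x}/𝔪^{n+1}` (Mathlib's quotient algebra on top of
`RatFn.algebraStalk`) is `K → 𝒪_{T,x} → 𝒪_{T,x}/𝔪^{n+1}`. [cite: GortzWedhorn2023, Lemma 24.72 (p. 409), proof, Steps (I)–(II) (p. 410)] -/
theorem algebraMap_thickRing_eq (n : ℕ) : algebraMap K (thickRing T x n) =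
    (Ideal.Quotient.mk _).comp (algebraMap K (stalkAt T x)) :=
  rfl

/-- The `K`-algebra structure of `κ(x)` is `K → 𝒪_{T,x} → κ(x)`. [cite: StacksProject, Tag 01I1 (Schemes, Lemma 26.6.4) and Tag 01J6 (Schemes, Lemma 26.13.1)] -/
theorem algebraMap_resField_eq : algebraMap K (resField T x) =
    (residue (stalkAt T x)).comp (algebraMap K (stalkAt T x)) :=
  rfl

/-- `K → 𝒪_{T,x} → A_n` is a scalar tower (Mathlib instance; recorded). [cite: GortzWedhorn2023, Lemma 24.72 (p. 409), proof, Steps (I)–(II) (p. 410)] -/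
theorem isScalarTower_stalkAt_thickRing (n : ℕ) : IsScalarTower K (stalkAt T x) (thickRing T x n) :=
  inferInstance

/-- `K → κ(x) → I_n` is a scalar tower (`K` acting on `I_n ⊆ A_{n+1}` through `A_{n+1}`). [cite: GortzWedhorn2023, Lemma 24.72 (p. 409), proof, Steps (I)–(II) (p. 410)] -/
theorem isScalarTower_resField_thickKer (n : ℕ) : IsScalarTower K (resField T x) (thickKer T x n) :=
  ⟨fun a μ y => (congrArg (· • y) (algebraMap_smul (stalkAt T x) a μ).symm).trans
    ((smul_assoc _ _ _).trans (algebraMap_smul (stalkAt T x) a (μ • y)))⟩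


/-! ### `Spec` of the structure maps -/

/-- **`Spec(K → 𝒪_{T,x})` is `Spec 𝒪_{T,x} → T → Spec K`** (Mathlib `Scheme.fromSpecStalk_toSpecΓ`,
`Scheme.toSpecΓ_naturality`, `SpecMap_ΓSpecIso_hom`). [cite: StacksProject, Tag 01I1 (Schemes, Lemma 26.6.4) and Tag 01J6 (Schemes, Lemma 26.13.1)] -/
theorem Spec_map_algebraMap_stalkAt :
    Spec.map (CommRingCat.ofHom (algebraMap K (stalkAt T x))) = T.left.fromSpecStalk x.1 ≫ T.hom := by
  rw [algebraMap_stalkAt_eq, Spec.map_comp, Spec.map_comp, ← Scheme.fromSpecStalk_toSpecΓ,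
    Category.assoc, Category.assoc]
  congr 1
  rw [← Scheme.toSpecΓ_naturality_assoc, ← SpecMap_ΓSpecIso_hom, ← Spec.map_comp, Iso.inv_hom_id,
    Spec.map_id, Category.comp_id]

/-- `Spec(K → A_n)` is the structure morphism `Spec(𝒪_{T,x}/𝔪^{n+1}) → Spec 𝒪_{T,x} → T → Spec K` of
the tree's `thickeningPt T x n`. [cite: GortzWedhorn2023, Lemma 24.72 (p. 409), proof, Steps (I)–(II) (p. 410)] -/
theorem thickeningPt_hom_eq_Spec_algebraMap (n : ℕ) :
    (thickeningPt T x.1 n).hom = Spec.map (CommRingCat.ofHom (algebraMap K (thickRing T x n))) := by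
  have h1 : CommRingCat.ofHom (algebraMap K (thickRing T x n)) =
      CommRingCat.ofHom (algebraMap K (stalkAt T x)) ≫ CommRingCat.ofHom (Ideal.Quotient.mk
        (maximalIdeal (stalkAt T x) ^ (n + 1))) := rfl
  rw [h1, Spec.map_comp, Spec_map_algebraMap_stalkAt]
  rfl

/-- **`thickeningPt T x n = specOver K (𝒪_{T,x}/𝔪^{n+1})`** as objects of `Over (Spec K)`: the
infinitesimal neighbourhood IS the spectrum of the `K`-algebra `A_n` with its structure map
`Spec (K → A_n)` (so the hypothesis `hs` of §1 holds for `s := (thickeningPt T x n).hom`, and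
`pullback P.hom (thickeningPt T x n).hom` is literally the scheme of §1). [cite: GortzWedhorn2023, Lemma 24.72 (p. 409), proof, Steps (I)–(II) (p. 410)] -/
theorem thickeningPt_eq_specOver (n : ℕ) : thickeningPt T x.1 n = specOver K (thickRing T x n) := by
  change Over.mk _ = Over.mk _
  exact congrArg Over.mk (thickeningPt_hom_eq_Spec_algebraMap T x n)

/-- `Spec(K → κ(x))` is `Spec κ(x) → T → Spec K` (Mathlib `Scheme.fromSpecResidueField`). [cite: StacksProject, Tag 01I1 (Schemes, Lemma 26.6.4) and Tag 01J6 (Schemes, Lemma 26.13.1)] -/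
theorem Spec_map_algebraMap_resField :
    Spec.map (CommRingCat.ofHom (algebraMap K (resField T x))) =
      T.left.fromSpecResidueField x.1 ≫ T.hom := by
  have h1 : CommRingCat.ofHom (algebraMap K (resField T x)) =
      CommRingCat.ofHom (algebraMap K (stalkAt T x)) ≫
        CommRingCat.ofHom (residue (stalkAt T x)) := rfl
  rw [h1, Spec.map_comp, Spec_map_algebraMap_stalkAt]
  rfl

/-- `residuePt T x = specOver K κ(x)` as objects of `Over (Spec K)`. [cite: StacksProject, Tag 01I1 (Schemes, Lemma 26.6.4) and Tag 01J6 (Schemes, Lemma 26.13.1)] -/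
theorem residuePt_eq_specOver : residuePt T x.1 = specOver K (resField T x) := by
  change Over.mk _ = Over.mk _
  exact congrArg Over.mk (Spec_map_algebraMap_resField T x).symm

/-! ### The transition and residue maps as `K`-algebra maps -/

/-- **`π_n : A_{n+1} → A_n` as a `K`-algebra homomorphism** (Mathlib `Ideal.Quotient.factorₐ K`; the
same ring map as the tree's `Γ(B)`-linear `thickπ`). [cite: GortzWedhorn2023, Lemma 24.72 (p. 409), proof, Steps (I)–(II) (p. 410)] -/
def thickπₐ (n : ℕ) : thickRing T x (n + 1) →ₐ[K] thickRing T x n :=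
  Ideal.Quotient.factorₐ K (pow_succ_le T x n)

/-- `thickπₐ` and `thickπ` are the same ring homomorphism. [cite: GortzWedhorn2023, Lemma 24.72 (p. 409), proof, Steps (I)–(II) (p. 410)] -/
theorem thickπₐ_toRingHom (n : ℕ) : (thickπₐ T x n).toRingHom = (thickπ T x n).toRingHom := rfl

/-- `thickπₐ` and `thickπ` agree pointwise. [cite: GortzWedhorn2023, Lemma 24.72 (p. 409), proof, Steps (I)–(II) (p. 410)] -/
@[simp] theorem thickπₐ_apply (n : ℕ) (r : thickRing T x (n + 1)) : thickπₐ T x n r = thickπ T x n r :=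
  rfl

/-- **`ρ_n : A_n → κ(x)` as a `K`-algebra homomorphism.** [cite: GortzWedhorn2023, Lemma 24.72 (p. 409), proof, Steps (I)–(II) (p. 410)] -/
def thickρₐ (n : ℕ) : thickRing T x n →ₐ[K] resField T x :=
  Ideal.Quotient.factorₐ K (pow_le T x n)

/-- `thickρₐ` and `thickρ` agree pointwise. [cite: GortzWedhorn2023, Lemma 24.72 (p. 409), proof, Steps (I)–(II) (p. 410)] -/
@[simp] theorem thickρₐ_apply (n : ℕ) (r : thickRing T x n) : thickρₐ T x n r = thickρ T x n r := rfl

/-- `ρ_n ∘ π_n = ρ_{n+1}` as `K`-algebra maps. [cite: GortzWedhorn2023, Lemma 24.72 (p. 409), proof, Steps (I)–(II) (p. 410)] -/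
theorem thickρₐ_comp_thickπₐ (n : ℕ) : (thickρₐ T x n).comp (thickπₐ T x n) = thickρₐ T x (n + 1) :=
  AlgHom.ext fun r => DFunLike.congr_fun (thickρ_comp_thickπ T x n) r

/-- The transition map of infinitesimal neighbourhoods is `Spec π_n` (definitional). [cite: GortzWedhorn2023, Lemma 24.72 (p. 409), proof, Steps (I)–(II) (p. 410)] -/
theorem thickeningPtTransition_left_eq (n : ℕ) :
    (thickeningPtTransition T x.1 n).left = Spec.map (CommRingCat.ofHom (thickπₐ T x n).toRingHom) :=
  rfl

/-- **The transition morphism `P ×_K Spec A_n → P ×_K Spec A_{n+1}` of §1 for `ψ = π_n` is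
`P ◁ thickeningPtTransition`, characterised by its two projections** (use with
`pullback.hom_ext`): any morphism with the same projections is `absTransition`. [cite: GortzWedhorn2020, Section (4.7) (pp. 107–108)] -/
theorem absTransition_eq_of {P : SchemeOver K} {R R' : Type u} [CommRing R] [Algebra K R]
    [CommRing R'] [Algebra K R'] {s : Spec (CommRingCat.of R) ⟶ Spec (CommRingCat.of K)}
    (hs : s = Spec.map (CommRingCat.ofHom (algebraMap K R)))
    {s' : Spec (CommRingCat.of R') ⟶ Spec (CommRingCat.of K)}
    (hs' : s' = Spec.map (CommRingCat.ofHom (algebraMap K R'))) (ψ : R →ₐ[K] R')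
    (τ : pullback P.hom s' ⟶ pullback P.hom s) (h₁ : τ ≫ pullback.fst P.hom s = pullback.fst P.hom s')
    (h₂ : τ ≫ pullback.snd P.hom s = pullback.snd P.hom s' ≫ Spec.map (CommRingCat.ofHom ψ.toRingHom)) :
    τ = absTransition P s hs s' hs' ψ :=
  pullback.hom_ext (by rw [h₁, absTransition_fst]) (by rw [h₂, absTransition_snd])

/-- For the thickenings: `(P ◁ thickeningPtTransition T x n).left` is the transition morphism of §1
for `ψ = π_n` (both have projections `pr_P` and `pr ≫ Spec π_n`). [cite: GortzWedhorn2023, Lemma 24.72 (p. 409), proof, Steps (I)–(II) (p. 410)] -/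
theorem whiskerLeft_thickeningPtTransition_left (P : SchemeOver K) (n : ℕ) :
    (P ◁ thickeningPtTransition T x.1 n).left =
      absTransition P (thickeningPt T x.1 (n + 1)).hom (thickeningPt_hom_eq_Spec_algebraMap T x (n + 1))
        (thickeningPt T x.1 n).hom (thickeningPt_hom_eq_Spec_algebraMap T x n) (thickπₐ T x n) := by
  refine absTransition_eq_of (thickeningPt_hom_eq_Spec_algebraMap T x (n + 1))
    (thickeningPt_hom_eq_Spec_algebraMap T x n) (thickπₐ T x n) _ ?_ ?_
  · change (P ◁ thickeningPtTransition T x.1 n).left ≫ (CartesianMonoidalCategory.fst P _).left =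
      (CartesianMonoidalCategory.fst P _).left
    rw [← Over.comp_left, CartesianMonoidalCategory.whiskerLeft_fst]
  · change (P ◁ thickeningPtTransition T x.1 n).left ≫ (CartesianMonoidalCategory.snd P _).left =
      (CartesianMonoidalCategory.snd P _).left ≫ (thickeningPtTransition T x.1 n).left
    rw [← Over.comp_left, CartesianMonoidalCategory.whiskerLeft_snd, Over.comp_left]

/-! ### `κ(x) = K` at a closed point (algebraically closed `K`, `T` locally of finite type) -/

/-- For `K` algebraically closed, `T → Spec K` locally of finite type and `x` a closed point, the
structure map `K → κ(x)` is Mathlib's `(residueFieldIsoBase T.hom x hx).inv`. [cite: StacksProject, Tag 01TF (Morphisms, Lemma 29.21.3: Hilbert Nullstellensatz)] -/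
theorem ofHom_algebraMap_resField_eq [IsAlgClosed K] [LocallyOfFiniteType T.hom]
    (hx : IsClosed ({x.1} : Set T.left)) :
    CommRingCat.ofHom (algebraMap K (resField T x)) = (residueFieldIsoBase T.hom x.1 hx).inv := by
  apply Spec.map_injective
  rw [Spec_map_algebraMap_resField]
  exact (SpecMap_residueFieldIsoBase_inv T.hom x.1 hx).symm

/-- **`κ(x) = K` at a closed point:** for `K` algebraically closed, `T → Spec K` locally of finite
type and `x` closed, `K → κ(x)` is bijective (Hilbert's Nullstellensatz; Mathlib
`residueFieldIsoBase`). [cite: StacksProject, Tag 01TF (Morphisms, Lemma 29.21.3: Hilbert Nullstellensatz)] -/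
theorem algebraMap_resField_bijective [IsAlgClosed K] [LocallyOfFiniteType T.hom]
    (hx : IsClosed ({x.1} : Set T.left)) : Function.Bijective (algebraMap K (resField T x)) := by
  have h := congrArg CommRingCat.Hom.hom (ofHom_algebraMap_resField_eq T x hx)
  rw [CommRingCat.hom_ofHom] at h
  rw [h]
  exact ConcreteCategory.bijective_of_isIso (residueFieldIsoBase T.hom x.1 hx).inv

/-- **`K ≃ₐ[K] κ(x)`** at a closed point (`K` algebraically closed, `T` locally of finite type).
[cite: StacksProject, Tag 01TF (Morphisms, Lemma 29.21.3: Hilbert Nullstellensatz)] -/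
def resFieldEquiv [IsAlgClosed K] [LocallyOfFiniteType T.hom] (hx : IsClosed ({x.1} : Set T.left)) :
    K ≃ₐ[K] resField T x :=
  AlgEquiv.ofBijective (Algebra.ofId K (resField T x)) (algebraMap_resField_bijective T x hx)

/-- `resFieldEquiv` is the structure map. [cite: StacksProject, Tag 01TF (Morphisms, Lemma 29.21.3: Hilbert Nullstellensatz)] -/
@[simp] theorem resFieldEquiv_apply [IsAlgClosed K] [LocallyOfFiniteType T.hom]
    (hx : IsClosed ({x.1} : Set T.left)) (c : K) : resFieldEquiv T x hx c = algebraMap K (resField T x) c :=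
  rfl

/-- `resFieldEquiv⁻¹ ∘ (K → κ(x)) = id`. [cite: StacksProject, Tag 01TF (Morphisms, Lemma 29.21.3: Hilbert Nullstellensatz)] -/
@[simp] theorem resFieldEquiv_symm_algebraMap [IsAlgClosed K] [LocallyOfFiniteType T.hom]
    (hx : IsClosed ({x.1} : Set T.left)) (c : K) :
    (resFieldEquiv T x hx).symm (algebraMap K (resField T x) c) = c :=
  (resFieldEquiv T x hx).symm_apply_apply c

/-- `(K → κ(x)) ∘ resFieldEquiv⁻¹ = id`. [cite: StacksProject, Tag 01TF (Morphisms, Lemma 29.21.3: Hilbert Nullstellensatz)] -/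
@[simp] theorem algebraMap_resFieldEquiv_symm [IsAlgClosed K] [LocallyOfFiniteType T.hom]
    (hx : IsClosed ({x.1} : Set T.left)) (μ : resField T x) :
    algebraMap K (resField T x) ((resFieldEquiv T x hx).symm μ) = μ :=
  (resFieldEquiv T x hx).apply_symm_apply μ

/-! ### The augmentations `A_n → K` and the small extensions `A_{n+1} → A_n` over `K` -/

section Aug

variable [IsAlgClosed K] [LocallyOfFiniteType T.hom] (hx : IsClosed ({x.1} : Set T.left))

/-- **The augmentation `ev_n : A_n = 𝒪_{T,x}/𝔪^{n+1} → K`** at a closed point (`ρ_n` followed by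
`κ(x) = K`), a `K`-algebra homomorphism. [cite: GortzWedhorn2023, Lemma 24.72 (p. 409), proof, Steps (I)–(II) (p. 410)] -/
def thickAug (n : ℕ) : thickRing T x n →ₐ[K] K :=
  ((resFieldEquiv T x hx).symm : resField T x →ₐ[K] K).comp (thickρₐ T x n)

/-- The augmentation unfolded. [cite: GortzWedhorn2023, Lemma 24.72 (p. 409), proof, Steps (I)–(II) (p. 410)] -/
theorem thickAug_apply (n : ℕ) (r : thickRing T x n) :
    thickAug T x hx n r = (resFieldEquiv T x hx).symm (thickρ T x n r) := rfl

/-- `K → κ(x)` after the augmentation is `ρ_n`. [cite: GortzWedhorn2023, Lemma 24.72 (p. 409), proof, Steps (I)–(II) (p. 410)] -/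
@[simp] theorem algebraMap_thickAug (n : ℕ) (r : thickRing T x n) :
    algebraMap K (resField T x) (thickAug T x hx n r) = thickρ T x n r := by
  rw [thickAug_apply, algebraMap_resFieldEquiv_symm]

/-- The augmentation is surjective. [cite: GortzWedhorn2023, Lemma 24.72 (p. 409), proof, Steps (I)–(II) (p. 410)] -/
theorem thickAug_surjective (n : ℕ) : Function.Surjective (thickAug T x hx n) :=
  (resFieldEquiv T x hx).symm.surjective.comp (thickρ_surjective T x n)

/-- `ev_n ∘ π_n = ev_{n+1}`. [cite: GortzWedhorn2023, Lemma 24.72 (p. 409), proof, Steps (I)–(II) (p. 410)] -/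
theorem thickAug_comp_thickπₐ (n : ℕ) :
    (thickAug T x hx n).comp (thickπₐ T x n) = thickAug T x hx (n + 1) := by
  rw [thickAug, AlgHom.comp_assoc, thickρₐ_comp_thickπₐ]
  rfl

/-- `ev_n r = 0 ↔ ρ_n r = 0`. [cite: GortzWedhorn2023, Lemma 24.72 (p. 409), proof, Steps (I)–(II) (p. 410)] -/
theorem thickAug_eq_zero_iff (n : ℕ) (r : thickRing T x n) : thickAug T x hx n r = 0 ↔ thickρ T x n r = 0 := by
  rw [thickAug_apply, map_eq_zero_iff _ (resFieldEquiv T x hx).symm.injective]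

/-- The kernel of the augmentation is the kernel of `ρ_n` (`= 𝔪/𝔪^{n+1}`). [cite: GortzWedhorn2023, Lemma 24.72 (p. 409), proof, Steps (I)–(II) (p. 410)] -/
theorem ker_thickAug (n : ℕ) :
    RingHom.ker (thickAug T x hx n) = RingHom.ker (thickρ T x n) := by
  ext r
  rw [RingHom.mem_ker, RingHom.mem_ker]
  exact thickAug_eq_zero_iff T x hx n r

variable [IsLocallyNoetherian T.left]

/-- **The framing `e_n : K^{d_n} ≅ I_n` over `K`** (the tree's `κ(x)`-basis `thickFrame` read through
`κ(x) = K`). [cite: GortzWedhorn2023, Lemma 24.72 (p. 409), proof, Steps (I)–(II) (p. 410)] -/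
def thickFrameₐ (n : ℕ) : (Fin (thickDim T x n) → K) ≃ₗ[K] thickKer T x n :=
  haveI := isScalarTower_resField_thickKer T x n
  (LinearEquiv.piCongrRight fun _ : Fin (thickDim T x n) => (resFieldEquiv T x hx).toLinearEquiv) ≪≫ₗ
    ((Module.finBasis (resField T x) (thickKer T x n)).equivFun.symm.restrictScalars K)

/-- `e_n` over `K` is the tree's `thickFrame` after `K ≅ κ(x)` coordinatewise. [cite: GortzWedhorn2023, Lemma 24.72 (p. 409), proof, Steps (I)–(II) (p. 410)] -/
theorem thickFrameₐ_apply (n : ℕ) (v : Fin (thickDim T x n) → K) :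
    thickFrameₐ T x hx n v = thickFrame T x n (fun ℓ => resFieldEquiv T x hx (v ℓ)) :=
  rfl

/-- **`A_{n+1} → A_n` is a small extension with framed kernel OVER `K`** at a closed point (`K`
algebraically closed, `T` locally noetherian and locally of finite type over `K`):
`Literature.RingTheory.Flat.IsSmallExtension (thickπₐ n) (thickAug (n+1)) (thickKer n) (thickFrameₐ n)`
— the tree's `thickSmallExtension` with `κ(x)` replaced by `K` (the shape of the field `small` of a
lift model over `K`). [cite: GortzWedhorn2023, Lemma 24.72 (p. 409), proof, Steps (I)–(II) (p. 410)] -/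
theorem thickSmallExtensionₐ (n : ℕ) :
    Literature.RingTheory.Flat.IsSmallExtension (thickπₐ T x n) (thickAug T x hx (n + 1))
      (thickKer T x n) (thickFrameₐ T x hx n) where
  surjective_π := thickπ_surjective T x n
  surjective_ρ := thickAug_surjective T x hx (n + 1)
  mem_ker_π := thickπ_eq_zero_iff_mem T x n
  isNilpotent_ker_ρ := by
    rw [ker_thickAug]
    exact (thickSmallExtension T x n).isNilpotent_ker_ρ
  smul_e r v := by
    rw [thickFrameₐ_apply, thickFrameₐ_apply, ← thickFrame_smul T x n r]
    have hfun : (fun ℓ => resFieldEquiv T x hx (thickAug T x hx (n + 1) r * v ℓ)) =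
        fun ℓ => thickρ T x (n + 1) r * resFieldEquiv T x hx (v ℓ) := by
      funext ℓ
      rw [map_mul, resFieldEquiv_apply, resFieldEquiv_apply, algebraMap_thickAug]
    rw [hfun]

end Aug

end Thickenings

section Charts

variable {K : Type u} [Field K]

/-! ### (α6) Affine charts of a `K`-scheme are `K`-morphisms for the `Sections` algebra structure -/

/-- **(α6) The chart `Spec Γ(U, 𝒪_Z) → Z` of an affine open `U` of a `K`-scheme `Z` is a morphism over
`Spec K`** for the `K`-algebra structure `Sections Z.hom U` of the tree's `Morphisms/CechH1`:
`hU.fromSpec ≫ Z.hom = Spec (K → Γ(U, 𝒪_Z))` (Mathlib `IsAffineOpen.SpecMap_appLE_fromSpec`,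
`IsAffineOpen.fromSpec_top`, `Scheme.isoSpec_Spec_inv`). [cite: StacksProject, Tag 01I1 (Schemes, Lemma 26.6.4)] -/
theorem fromSpec_comp_hom_eq_Spec_algebraMap (Z : SchemeOver K) {U : Z.left.Opens} (hU : IsAffineOpen U) :
    hU.fromSpec ≫ Z.hom = Spec.map (CommRingCat.ofHom (algebraMap K (Sections Z.hom U))) := by
  calc hU.fromSpec ≫ Z.hom
      = Spec.map (Z.hom.appLE ⊤ U le_top) ≫ (isAffineOpen_top (Spec (.of K))).fromSpec :=
        (IsAffineOpen.SpecMap_appLE_fromSpec Z.hom (isAffineOpen_top _) hU le_top).symm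
    _ = Spec.map (Z.hom.appLE ⊤ U le_top) ≫ Spec.map (Scheme.ΓSpecIso (.of K)).inv := by
        rw [IsAffineOpen.fromSpec_top, Scheme.isoSpec_Spec_inv]
    _ = Spec.map ((Scheme.ΓSpecIso (.of K)).inv ≫ Z.hom.appLE ⊤ U le_top) := (Spec.map_comp _ _).symm
    _ = Spec.map (CommRingCat.ofHom (algebraMap K (Sections Z.hom U))) := rfl

/-- (α6′) The chart as a morphism of `Over (Spec K)`: `specOver K Γ(U, 𝒪_Z) → Z`. [cite: StacksProject, Tag 01I1 (Schemes, Lemma 26.6.4)] -/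
def fromSpecOver (Z : SchemeOver K) {U : Z.left.Opens} (hU : IsAffineOpen U) :
    specOver K (Sections Z.hom U) ⟶ Z :=
  Over.homMk hU.fromSpec (fromSpec_comp_hom_eq_Spec_algebraMap Z hU)

/-- The scheme morphism underlying `fromSpecOver` is `hU.fromSpec`. [cite: StacksProject, Tag 01I1 (Schemes, Lemma 26.6.4)] -/
@[simp] theorem fromSpecOver_left (Z : SchemeOver K) {U : Z.left.Opens} (hU : IsAffineOpen U) :
    (fromSpecOver Z hU).left = hU.fromSpec :=
  rfl

end Charts

end Literature.AlgebraicGeometry.Motives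

end
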